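import Literature.AlgebraicGeometry.HodgeTheory.HodgeFiltrationAnalyticFramesChartBall
import Literature.AlgebraicGeometry.HodgeTheory.HarmonicProjectorFamilyContinuousDep
import Literature.AlgebraicGeometry.HodgeTheory.BettiWedgePairingNondegenerate
import Literature.AlgebraicGeometry.HodgeTheory.AlgebraicChartOrientation
import Literature.AlgebraicGeometry.Motives.HodgeNumberFamilyConstancy
import Literature.AlgebraicGeometry.Motives.QuasiProjectiveKaehlerMetric
import Literature.AlgebraicGeometry.Motives.SmoothProjectiveFamilyHolomorphicSubmersion
import Literature.Geometry.Kaehler.EhresmannChartBallTrivialisationInverse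
import Literature.Geometry.Kaehler.ChartBallTransportDefects
import Literature.NumberTheory.Transcendental.FormIntegrationVolumePosProofs
import Literature.NumberTheory.Transcendental.FormIntegrationVolumeFormProofs
import Literature.NumberTheory.Transcendental.ComplexDeRhamFinite
import Literature.NumberTheory.Transcendental.AnalytificationSecondCountableProofs
import HarnessLib

/-!
# Analytic frames of the Hodge bundles of a smooth projective family over a chart ball of the base
# (Voisin I Thm. 10.3 / Griffiths 1968 Thm. 1.1 — the assembly step K7 of the programme «GRIFFITHS-HOLOMORPHY»)

Topic: Hodge theory in families. Theorems only, no definition, no named fact. Written by the prover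
seat `hodge-nonav-prover-Bx` (g18, cell `hodge-nonav`) as brick **K7-final, part 1** of the programme
«GRIFFITHS-HOLOMORPHY» (memo `PROGRAMME-GRIFFITHS-HOLOMORPHY-Bx-g17.md`, spec `K7-SPEC.md`; target
`Literature.AlgebraicGeometry.HodgeTheory.Griffiths1968_holomorphicHodgeSubbundlesQP`, discharged in
the companion file `GriffithsHolomorphicHodgeSubbundlesQPHolds` by feeding the output of this file to
`exists_hodgeFrames_of_chartBallFrames` (brick K7h of `hodge-nonav-20241-p1`)).

SETTING. `f : 𝒳 ⟶ S` a smooth projective family of relative dimension `n` over `S` smooth of relative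
dimension `d` and separated, with `𝒳` quasi-projective; algebraic-chart atlases on `𝒳(ℂ)`, `S(ℂ)` and
on the fibres `X_b(ℂ) = (fiberOver f b)(ℂ)` (models `algebraicModel`), a point `t₁ ∈ S(ℂ)`, a degree `k`.

RESULT `exists_chartBall_hodgeFrames` (all `k`; `…_of_isSmoothProjectiveFamily` for `k < 2n`,
`…_of_two_mul_le` for `2n ≤ k`): the Ehresmann chart-ball trivialisation `Φ` of `𝒳(ℂ)` over a ball
`D = ball (c t₁) r` of the holomorphic chart `c` of `S(ℂ)` at `t₁`, with its clauses and the DEPENDENT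
fibre diffeomorphisms `e p : X_{t₁}(ℂ) ≃ X_{c⁻¹ p}(ℂ)` (`p ∈ D`), and, on a COMMON smaller ball
`ball (c t₁) r₀`, for EVERY `p : ℕ`, maps `w p 1, …, w p (R p) : ℂᵈ → H^k_dR(X_{t₁}(ℂ); ℂ)` with analytic
coordinates whose values at each `z` form a basis of the transported filtration step
`(e z)^* F^pH^k(X_{c⁻¹ z}(ℂ))`, `F^p = ⨆_{p ≤ p'} H^{p',k-p'}` — exactly the input `hw` of
`exists_hodgeFrames_of_chartBallFrames`.

PROOF (`k < 2n`), an assembly of tree theorems only: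
* K7a `exists_isKaehler_of_isQuasiProjectiveOver`: a Kähler metric `G` on `𝒳(ℂ)`; K0
  `exists_fibreMetric_isKaehler`: the induced Kähler metrics `g b` on the fibres;
* F-E `isProperHolomorphicSubmersion_and_isFibreEmbedding_of_isSmoothProjectiveFamily` and K0b
  `IsProperHolomorphicSubmersion.exists_chartBall_trivialisation_inverse`: `Φ`, `Λ`, `e`;
* the complex orientation `o₀` of `X_{t₁}(ℂ)` (`exists_orientation_cintegral_ne_zero_algebraicChart`),
  its volume form smooth (`isSmoothForm_riemannianVolumeForm_of_isContinuousOrientation_holds`), an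
  oriented orthonormal frame field (`OrthonormalBasis.adjustToOrientation`);
* K1 `exists_continuousOn_harmonicProjector_family_dep`, invoked for every `p` (operators `L p`, the
  transported orientations `oK p z`, harmonic representatives); the FULL harmonic transport is
  `R := L (k+1)` and its representation clause towards K7g follows from the KERNEL clause of `L p` and
  `mem_hodgeFiltration_iff_typeComponent_eq_zero` applied to the harmonic representative of the
  `(k+1)`-call (no uniqueness of harmonic representatives is needed);
* K3 `eventually_finrank_hodgeFiltration_eq_of_fibres` (Betti constancy from the diffeomorphisms
  `e z`, `complexDeRhamCohomology.map_diffeomorph_bijective`): `dim F^p` is constant on a ball;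
* K4b `BettiUniverse.exists_cintegral_wedge_ne_zero_of_mk_ne_zero` with the volume form of `oK (k+1) z`
  (`integral_riemannianVolumeForm_pos_holds`): Poincaré duality for the wedge pairing on the fibres
  (`exists_cintegral_wedge_ne_zero_of_riemannianVolumeForm`);
* K7g `exists_analyticFrames_hodgeFiltration_chartBall` for each `p ≤ k + 1`, and the common radius
  `min r (min_{p ≤ k+1} r₀ p)` (for `p > k` the step `F^p` is that of `p = k + 1`, i.e. `0`).
For `2n ≤ k` no analysis is needed: `F^p = H^{2n} = H^{n,n}` (all of it) when `k = 2n`, `p ≤ n`, and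
`F^p = 0` otherwise (`biSup_hodgePQ_eq_of_two_mul_le`, from `hodgePQ_eq_bot_of_finrank_lt_fst/snd` and
the Hodge decomposition carried by `algebraicModel`), so the frames are a fixed basis of
`H^k_dR(X_{t₁})` (constant, transported by the isomorphisms `(e z)^*`) or empty.

Honest scope: an assembly of the cell's bricks; nothing in this file says HC or any rung is proved,
and Griffiths' theorem itself is only concluded in the companion file.

## References

* [VoisinHodgeI2002] C. Voisin, Hodge Theory and Complex Algebraic Geometry I, CUP (2002), §9.1.1
  Thm. 9.3, §9.3.2 Prop. 9.20, §10.1.2 Thm. 10.9, §10.2.1 Thm. 10.3, §10.2.2.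
* [Griffiths1968PeriodsII] P. Griffiths, Periods of integrals on algebraic manifolds II, Amer. J.
  Math. 90 (1968), Thm. 1.1.
* [Kodaira2005] K. Kodaira, Complex Manifolds and Deformation of Complex Structures, §2.3 Thm. 2.5,
  §7.2 Thm. 7.3.
-/

noncomputable section

open scoped Manifold ContDiff Topology TensorProduct
open CategoryTheory AlgebraicGeometry Bundle Function Set Filter Metric Complex Module Finset
open Literature.AlgebraicTopology.SingularHomology
open Literature.Geometry.Kaehler Literature.Geometry.Manifold Literature.NumberTheory.Transcendental
open Literature.AlgebraicGeometry.Motives Literature.Analysis.Complex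

namespace Literature.AlgebraicGeometry.HodgeTheory

-- The identification `TangentSpace I x = E` is an abuse of definitional equality; as in the tree's
-- form files we let `isDefEq` unfold it.
set_option backward.isDefEq.respectTransparency false

section PD

/-- **Poincaré duality for the wedge pairing on `X(ℂ)` in the algebraic charts, for ANY orientation
with smooth Riemannian volume form** (brick K4b `exists_cintegral_wedge_ne_zero_of_mk_ne_zero` fed with
the volume form: `∫ vol_o > 0`, `integral_riemannianVolumeForm_pos_holds`). For `X` smooth projective
of dimension `n`, a smooth metric `g` on `X(ℂ)`, an orientation field `o` with `vol_o` smooth, and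
`k + l = 2n`: every non-zero class `[θ] ∈ H^k_dR` pairs non-trivially with some closed `l`-form.
[cite: VoisinHodgeI2002, §5.3.2 Thm. 5.30 and §7.1.2] -/
theorem exists_cintegral_wedge_ne_zero_of_riemannianVolumeForm {n : ℕ} {X : SchemeOver ℂ}
    (hX : IsSmoothProjective n X) [Fact (Module.finrank ℝ (Fin n → ℂ) = 2 * n)]
    {k l : ℕ} (hkl : k + l = 2 * n) :
    letI : ChartedSpace (Fin n → ℂ) (ComplexPoints X) := (algebraicModel hX).chartedSpace
    haveI : IsManifold 𝓘(ℝ, Fin n → ℂ) ∞ (ComplexPoints X) := (algebraicModel hX).isManifold_real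
    haveI : T2Space (ComplexPoints X) := ComplexPoints.t2Space_of_isSmoothProjective hX
    haveI : SigmaCompactSpace (ComplexPoints X) := (algebraicModel hX).sigmaCompactSpace
    ∀ (g : ContMDiffRiemannianMetric 𝓘(ℝ, Fin n → ℂ) ∞ (Fin n → ℂ)
        (fun x : ComplexPoints X ↦ TangentSpace 𝓘(ℝ, Fin n → ℂ) x))
      (o : (x : ComplexPoints X) → Orientation ℝ (TangentSpace 𝓘(ℝ, Fin n → ℂ) x) (Fin (2 * n))),
    letI : RiemannianBundle (fun x : ComplexPoints X ↦ TangentSpace 𝓘(ℝ, Fin n → ℂ) x) :=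
      ⟨g.toRiemannianMetric⟩
    IsSmoothForm (riemannianVolumeForm o) →
    ∀ θ : cclosedSmoothForms (Fin n → ℂ) (ComplexPoints X) k,
      complexDeRhamCohomology.mk (Fin n → ℂ) (ComplexPoints X) k θ ≠ 0 →
      ∃ γ : cclosedSmoothForms (Fin n → ℂ) (ComplexPoints X) l,
        cintegral o ((θ.1.wedge γ.1).castDeg hkl) ≠ 0 := by
  letI : ChartedSpace (Fin n → ℂ) (ComplexPoints X) := (algebraicModel hX).chartedSpace
  haveI : IsManifold 𝓘(ℂ, Fin n → ℂ) ω (ComplexPoints X) := (algebraicModel hX).isManifold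
  haveI : IsManifold 𝓘(ℝ, Fin n → ℂ) ∞ (ComplexPoints X) := (algebraicModel hX).isManifold_real
  haveI : T2Space (ComplexPoints X) := ComplexPoints.t2Space_of_isSmoothProjective hX
  haveI : SigmaCompactSpace (ComplexPoints X) := (algebraicModel hX).sigmaCompactSpace
  haveI : CompactSpace (ComplexPoints X) := ComplexPoints.compactSpace_of_isSmoothProjective hX
  haveI : Nonempty (ComplexPoints X) := (algebraicModel hX).nonempty_carrier hX
  intro g o
  letI : RiemannianBundle (fun x : ComplexPoints X ↦ TangentSpace 𝓘(ℝ, Fin n → ℂ) x) :=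
    ⟨g.toRiemannianMetric⟩
  haveI : IsContMDiffRiemannianBundle 𝓘(ℝ, Fin n → ℂ) ∞ (Fin n → ℂ)
      (fun x : ComplexPoints X ↦ TangentSpace 𝓘(ℝ, Fin n → ℂ) x) :=
    ⟨g.inner, g.contMDiff, fun _ _ _ ↦ rfl⟩
  haveI : IsContinuousRiemannianBundle (Fin n → ℂ)
      (fun x : ComplexPoints X ↦ TangentSpace 𝓘(ℝ, Fin n → ℂ) x) :=
    isContinuousRiemannianBundle_of_isContMDiffRiemannianBundle 𝓘(ℝ, Fin n → ℂ) ∞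
  intro ho θ hθ
  letI : MeasurableSpace (algebraicModel hX).model := (inferInstance : MeasurableSpace (Fin n → ℂ))
  haveI : BorelSpace (algebraicModel hX).model := (inferInstance : BorelSpace (Fin n → ℂ))
  haveI : Fact (Module.finrank ℝ (algebraicModel hX).model = 2 * n) :=
    (inferInstance : Fact (Module.finrank ℝ (Fin n → ℂ) = 2 * n))
  have hoc : IsContinuousOrientation o :=
    isContinuousOrientation_of_isSmoothForm_riemannianVolumeForm_holds o ho
  have hI : ∃ F : cclosedSmoothForms (Fin n → ℂ) (ComplexPoints X) (2 * n),
      cintegral o F.1 ≠ 0 := by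
    refine ⟨⟨(riemannianVolumeForm o).ofReal, ofReal_mem_cclosedSmoothForms
      ⟨ho, mextDeriv_eq_zero_of_top_degree _⟩⟩, ?_⟩
    change cintegral o (riemannianVolumeForm o).ofReal ≠ 0
    rw [cintegral_ofReal]
    exact_mod_cast (integral_riemannianVolumeForm_pos_holds o ho).ne'
  exact BettiUniverse.exists_cintegral_wedge_ne_zero_of_mk_ne_zero hX (algebraicModel hX)
    (integrationDeRhamIsoFamily (Fin n → ℂ)) integrationDeRhamIsoFamily_isMultiplicative
    hkl rfl o hoc hI θ hθ

end PD

section Degenerate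

/-- **The Hodge filtration in degrees `k ≥ 2 dim`**: on a manifold charted on `ℂⁿ` whose de Rham
cohomology in degree `k` is the direct sum of the `H^{p,q}` (Hodge decomposition), for `2n ≤ k` the
step `F^p = ⨆_{p ≤ p'} H^{p',k-p'}` is everything when `k = 2n` and `p ≤ n` (only `H^{n,n}` survives)
and `0` otherwise (`H^{p',q'} = 0` for `p' > n` or `q' > n`). [cite: VoisinHodgeI2002, §2.3.1 and §7.1.1] -/
theorem biSup_hodgePQ_eq_of_two_mul_le {n k : ℕ} (hk : 2 * n ≤ k) {M : Type*} [TopologicalSpace M]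
    [ChartedSpace (Fin n → ℂ) M]
    (hint : DirectSum.IsInternal fun pq : ↥(antidiagonal k) ↦ hodgePQ (Fin n → ℂ) M k pq.1.1 pq.1.2)
    (p : ℕ) :
    (⨆ pq ∈ {pq ∈ antidiagonal k | p ≤ pq.1}, hodgePQ (Fin n → ℂ) M k pq.1 pq.2) =
      if k = 2 * n ∧ p ≤ n then ⊤ else ⊥ := by
  have hfin : Module.finrank ℂ (Fin n → ℂ) = n := by simp
  -- the pieces off `(n, n)` vanish
  have hbot : ∀ pq ∈ antidiagonal k, pq ≠ (n, n) → hodgePQ (Fin n → ℂ) M k pq.1 pq.2 = ⊥ := by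
    intro pq hpq hne
    have hsum := HasAntidiagonal.mem_antidiagonal.1 hpq
    by_cases h1 : n < pq.1
    · exact hodgePQ_eq_bot_of_finrank_lt_fst M (by rw [hfin]; exact h1)
    · have h2 : n < pq.2 := by
        by_contra h2
        exact hne (Prod.ext (by omega) (by omega))
      exact hodgePQ_eq_bot_of_finrank_lt_snd M (by rw [hfin]; exact h2)
  split_ifs with hcase
  · obtain ⟨hk2, hpn⟩ := hcase
    refine eq_top_iff.2 ?_
    rw [← hint.submodule_iSup_eq_top]
    refine iSup_le fun pq ↦ ?_
    by_cases hne : (pq : ℕ × ℕ) = (n, n)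
    · refine le_iSup₂_of_le (pq : ℕ × ℕ) (Finset.mem_filter.2 ⟨pq.2, ?_⟩) le_rfl
      rw [hne]; exact hpn
    · rw [hbot pq pq.2 hne]
      exact bot_le
  · refine le_bot_iff.1 (iSup₂_le fun pq hpq ↦ ?_)
    obtain ⟨hpq', hppq⟩ := Finset.mem_filter.1 hpq
    have hsum := HasAntidiagonal.mem_antidiagonal.1 hpq'
    by_cases hne : pq = (n, n)
    · exfalso
      rw [hne] at hppq hsum
      exact hcase ⟨by simpa [two_mul] using hsum.symm, hppq⟩
    · exact (hbot pq hpq' hne).le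

end Degenerate

section Frames

variable {𝒳 S : SchemeOver ℂ} (f : 𝒳 ⟶ S)

set_option maxHeartbeats 400000 in
/-- **Analytic frames of all the Hodge bundles `F^p𝓗^k`, `k < 2 dim`, of a smooth projective family with
quasi-projective total space over a chart ball of the base** (Voisin I Thm. 10.3 ∕ Thm. 10.9, Griffiths
1968 Thm. 1.1, in the local de Rham form consumed by `exists_hodgeFrames_of_chartBallFrames`; statement,
setting and the assembly in the module docstring). Output: the chart-ball trivialisation `Φ` at `t₁`
with the clauses of `exists_chartBall_trivialisation_inverse`, the dependent fibre diffeomorphisms `e`,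
a common radius `0 < r₀ ≤ r`, and for every `p` maps `w p i : ℂᵈ → H^k_dR(X_{t₁}(ℂ); ℂ)` with analytic
coordinates on `ball (c t₁) r₀` framing `(e z)^* F^pH^k(X_{c⁻¹ z}(ℂ))` at each `z`. (The heartbeat
bound covers the elaboration of the long dependent context, not any search.)
[cite: VoisinHodgeI2002, §10.2.1 Thm. 10.3 and §10.1.2 Thm. 10.9] [cite: Griffiths1968PeriodsII, Thm. 1.1]
[cite: Kodaira2005, §7.2 Thm. 7.3] -/
theorem exists_chartBall_hodgeFrames_of_isSmoothProjectiveFamily {n d : ℕ} (k : ℕ) (hkn : k < 2 * n)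
    (hf : IsSmoothProjectiveFamily f n) (h𝒳 : IsQuasiProjectiveOver 𝒳)
    [AlgebraicGeometry.SmoothOfRelativeDimension d S.hom] [AlgebraicGeometry.IsSeparated S.hom]
    (t₁ : ComplexPoints S) :
    letI := Motives.smoothOfRelativeDimension_total (m := d) f hf
    letI : AlgebraicGeometry.Smooth 𝒳.hom := AlgebraicGeometry.SmoothOfRelativeDimension.smooth (n + d) _
    letI : AlgebraicGeometry.LocallyOfFiniteType 𝒳.hom := inferInstance
    letI : AlgebraicGeometry.Smooth S.hom := AlgebraicGeometry.SmoothOfRelativeDimension.smooth d _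
    letI : AlgebraicGeometry.LocallyOfFiniteType S.hom := inferInstance
    letI := chartedSpaceOfCharts (ComplexPoints.algebraicChart 𝒳 (n + d))
      (ComplexPoints.mem_algebraicChart_source 𝒳 (n + d))
    letI := chartedSpaceOfCharts (ComplexPoints.algebraicChart S d)
      (ComplexPoints.mem_algebraicChart_source S d)
    letI : ∀ b : ComplexPoints S, ChartedSpace (Fin n → ℂ) (ComplexPoints (fiberOver f b)) :=
      fun b ↦ (algebraicModel (hf.isSmoothProjective b)).chartedSpace
    haveI : ∀ b : ComplexPoints S, IsManifold 𝓘(ℝ, Fin n → ℂ) ∞ (ComplexPoints (fiberOver f b)) :=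
      fun b ↦ (algebraicModel (hf.isSmoothProjective b)).isManifold_real
    ∃ (r : ℝ) (Φ : (Fin d → ℂ) → ComplexPoints (fiberOver f t₁) → ComplexPoints 𝒳)
      (e : ∀ p ∈ ball (extChartAt 𝓘(ℂ, Fin d → ℂ) t₁ t₁) r,
        ComplexPoints (fiberOver f t₁) ≃ₘ^∞⟮𝓘(ℝ, Fin n → ℂ), 𝓘(ℝ, Fin n → ℂ)⟯
          ComplexPoints (fiberOver f ((extChartAt 𝓘(ℂ, Fin d → ℂ) t₁).symm p)))
      (r₀ : ℝ) (R : ℕ → ℕ)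
      (w : ∀ p : ℕ, Fin (R p) → (Fin d → ℂ) →
        complexDeRhamCohomology (Fin n → ℂ) (ComplexPoints (fiberOver f t₁)) k),
      0 < r ∧
      ball (extChartAt 𝓘(ℂ, Fin d → ℂ) t₁ t₁) r ⊆ (extChartAt 𝓘(ℂ, Fin d → ℂ) t₁).target ∧
      (∀ x, Φ (extChartAt 𝓘(ℂ, Fin d → ℂ) t₁ t₁) x = AlgPoints.map (fiberι f t₁) x) ∧
      (∀ p ∈ ball (extChartAt 𝓘(ℂ, Fin d → ℂ) t₁ t₁) r, ∀ x,
        AlgPoints.map f (Φ p x) = (extChartAt 𝓘(ℂ, Fin d → ℂ) t₁).symm p) ∧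
      ContMDiffOn (𝓘(ℝ, Fin d → ℂ).prod 𝓘(ℝ, Fin n → ℂ)) 𝓘(ℝ, Fin (n + d) → ℂ) ∞ (uncurry Φ)
        (ball (extChartAt 𝓘(ℂ, Fin d → ℂ) t₁ t₁) r ×ˢ univ) ∧
      (∀ p ∈ ball (extChartAt 𝓘(ℂ, Fin d → ℂ) t₁ t₁) r,
        ContMDiff 𝓘(ℝ, Fin n → ℂ) 𝓘(ℝ, Fin (n + d) → ℂ) ∞ (Φ p) ∧ Injective (Φ p) ∧
          (∀ x, Injective (mfderiv 𝓘(ℝ, Fin n → ℂ) 𝓘(ℝ, Fin (n + d) → ℂ) (Φ p) x)) ∧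
          range (Φ p) = (AlgPoints.map f : ComplexPoints 𝒳 → ComplexPoints S) ⁻¹'
            {(extChartAt 𝓘(ℂ, Fin d → ℂ) t₁).symm p}) ∧
      (∀ p (hp : p ∈ ball (extChartAt 𝓘(ℂ, Fin d → ℂ) t₁ t₁) r), ∀ x,
        AlgPoints.map (fiberι f ((extChartAt 𝓘(ℂ, Fin d → ℂ) t₁).symm p)) (e p hp x) = Φ p x) ∧
      0 < r₀ ∧ r₀ ≤ r ∧
      (∀ p i (φ : Module.Dual ℂ (complexDeRhamCohomology (Fin n → ℂ) (ComplexPoints (fiberOver f t₁)) k)),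
        AnalyticOnNhd ℂ (fun z ↦ φ (w p i z)) (ball (extChartAt 𝓘(ℂ, Fin d → ℂ) t₁ t₁) r₀)) ∧
      (∀ p z (_ : z ∈ ball (extChartAt 𝓘(ℂ, Fin d → ℂ) t₁ t₁) r₀)
        (hzr : z ∈ ball (extChartAt 𝓘(ℂ, Fin d → ℂ) t₁ t₁) r),
        LinearIndependent ℂ (fun i ↦ w p i z) ∧
        Submodule.span ℂ (Set.range fun i ↦ w p i z) =
          (⨆ pq ∈ {pq ∈ antidiagonal k | p ≤ pq.1},
            hodgePQ (Fin n → ℂ) (ComplexPoints (fiberOver f ((extChartAt 𝓘(ℂ, Fin d → ℂ) t₁).symm z)))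
              k pq.1 pq.2).map
            (complexDeRhamCohomology.map (Fin n → ℂ) (e z hzr).contMDiff k)) := by
  -- ### instances (as in `exists_weightFrames_of_relativeForms`)
  haveI := Motives.smoothOfRelativeDimension_total (m := d) f hf
  haveI : AlgebraicGeometry.Smooth 𝒳.hom := AlgebraicGeometry.SmoothOfRelativeDimension.smooth (n + d) _
  haveI : AlgebraicGeometry.LocallyOfFiniteType 𝒳.hom := inferInstance
  haveI : AlgebraicGeometry.Smooth S.hom := AlgebraicGeometry.SmoothOfRelativeDimension.smooth d _
  haveI : AlgebraicGeometry.LocallyOfFiniteType S.hom := inferInstance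
  letI csT := chartedSpaceOfCharts (ComplexPoints.algebraicChart 𝒳 (n + d))
    (ComplexPoints.mem_algebraicChart_source 𝒳 (n + d))
  letI csB := chartedSpaceOfCharts (ComplexPoints.algebraicChart S d)
    (ComplexPoints.mem_algebraicChart_source S d)
  classical
  have hX : ∀ t : ComplexPoints S, IsSmoothProjective n (fiberOver f t) := fun t ↦ hf.isSmoothProjective t
  haveI : IsManifold 𝓘(ℂ, Fin (n + d) → ℂ) ω (ComplexPoints 𝒳) := isManifold_algebraicChart 𝒳 (n + d)
  haveI : IsManifold 𝓘(ℂ, Fin d → ℂ) ω (ComplexPoints S) := isManifold_algebraicChart S d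
  haveI : IsManifold 𝓘(ℝ, Fin (n + d) → ℂ) ∞ (ComplexPoints 𝒳) := isManifold_real_of_isManifold_complex
  haveI : IsManifold 𝓘(ℝ, Fin d → ℂ) ∞ (ComplexPoints S) := isManifold_real_of_isManifold_complex
  haveI : AlgebraicGeometry.IsSeparated 𝒳.hom := h𝒳.isVarietyPair_ofScheme.isSeparated
  haveI : T2Space (ComplexPoints 𝒳) := ComplexPoints.t2Space_of_isSeparated 𝒳
  haveI : T2Space (ComplexPoints S) := ComplexPoints.t2Space_of_isSeparated S
  haveI : AlgebraicGeometry.QuasiCompact 𝒳.hom := h𝒳.isVarietyPair_ofScheme.quasiCompact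
  haveI : CompactSpace 𝒳.left := QuasiCompact.compactSpace_of_compactSpace 𝒳.hom
  haveI : SecondCountableTopology (ComplexPoints 𝒳) :=
    ComplexPoints.secondCountableTopology_of_compactSpace_holds _
  haveI : LocallyCompactSpace (ComplexPoints 𝒳) := ChartedSpace.locallyCompactSpace (Fin (n + d) → ℂ) _
  haveI : SigmaCompactSpace (ComplexPoints 𝒳) := sigmaCompactSpace_of_locallyCompact_secondCountable
  haveI : NormalSpace (ComplexPoints 𝒳) := inferInstance
  -- the fibres, with the algebraic charts of `algebraicModel`
  letI csF : ∀ b : ComplexPoints S, ChartedSpace (Fin n → ℂ) (ComplexPoints (fiberOver f b)) :=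
    fun b ↦ (algebraicModel (hX b)).chartedSpace
  haveI : ∀ b, IsManifold 𝓘(ℂ, Fin n → ℂ) ω (ComplexPoints (fiberOver f b)) :=
    fun b ↦ (algebraicModel (hX b)).isManifold
  haveI : ∀ b, IsManifold 𝓘(ℝ, Fin n → ℂ) ∞ (ComplexPoints (fiberOver f b)) :=
    fun b ↦ (algebraicModel (hX b)).isManifold_real
  haveI : ∀ b, T2Space (ComplexPoints (fiberOver f b)) :=
    fun b ↦ ComplexPoints.t2Space_of_isSmoothProjective (hX b)
  haveI : ∀ b, CompactSpace (ComplexPoints (fiberOver f b)) :=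
    fun b ↦ ComplexPoints.compactSpace_of_isSmoothProjective (hX b)
  haveI : ∀ b, SigmaCompactSpace (ComplexPoints (fiberOver f b)) :=
    fun b ↦ (algebraicModel (hX b)).sigmaCompactSpace
  haveI hne : ∀ b : ComplexPoints S, Nonempty (ComplexPoints (fiberOver f b)) :=
    fun b ↦ (algebraicModel (hX b)).nonempty_carrier (hX b)
  -- `f(ℂ)` is a proper holomorphic submersion; the fibre embeddings
  obtain ⟨hπ, hιall⟩ := isProperHolomorphicSubmersion_and_isFibreEmbedding_of_isSmoothProjectiveFamily
    (m := d) f hf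
  have hdim : Module.finrank ℂ (Fin n → ℂ) + Module.finrank ℂ (Fin d → ℂ) =
      Module.finrank ℂ (Fin (n + d) → ℂ) := finrank_fibre_add_base n d
  -- ### a Kähler metric on `𝒳(ℂ)` (quasi-projective) and the induced Kähler metrics on the fibres
  obtain ⟨G, hG⟩ := exists_isKaehler_of_isQuasiProjectiveOver (e := n + d) h𝒳
  have hgex : ∀ b : ComplexPoints S, ∃ g : ContMDiffRiemannianMetric 𝓘(ℝ, Fin n → ℂ) ∞ (Fin n → ℂ)
      (fun x : ComplexPoints (fiberOver f b) ↦ TangentSpace 𝓘(ℝ, Fin n → ℂ) x),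
      g.toRiemannianMetric.IsKaehler ∧
      ∀ (x : ComplexPoints (fiberOver f b)) (v w : TangentSpace 𝓘(ℝ, Fin n → ℂ) x), g.inner x v w =
        G.inner (AlgPoints.map (fiberι f b) x)
          (mfderiv 𝓘(ℝ, Fin n → ℂ) 𝓘(ℝ, Fin (n + d) → ℂ) (AlgPoints.map (fiberι f b)) x v)
          (mfderiv 𝓘(ℝ, Fin n → ℂ) 𝓘(ℝ, Fin (n + d) → ℂ) (AlgPoints.map (fiberι f b)) x w) := fun b ↦
    exists_fibreMetric_isKaehler G hG (O := Set.univ)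
      (ι := fun b ↦ (AlgPoints.map (fiberι f b) : ComplexPoints (fiberOver f b) → ComplexPoints 𝒳))
      (fun b _ ↦ hιall b) (Set.mem_univ b)
  choose g hgK hg using hgex
  -- ### the chart-ball trivialisation at `t₁` with its inverse chart (brick K0b)
  obtain ⟨r, Φ, Λ, hr, hbt, hbO, hΦ0, hπΦ, hΦsm, himm, hee, -, hΛs, hΛΦ, -⟩ :=
    hπ.exists_chartBall_trivialisation_inverse isOpen_univ (Set.mem_univ t₁)
      (X := fun b ↦ ComplexPoints (fiberOver f b))
      (ι := fun b ↦ (AlgPoints.map (fiberι f b) : ComplexPoints (fiberOver f b) → ComplexPoints 𝒳))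
      (fun b _ ↦ hιall b)
  choose e he using hee
  -- ### the reference data on `X_{t₁}`: the fibre metrics as instances, the complex orientation,
  -- an oriented orthonormal frame field
  letI iX : ∀ b, RiemannianBundle
      (fun x : ComplexPoints (fiberOver f b) ↦ TangentSpace 𝓘(ℝ, Fin n → ℂ) x) :=
    fun b ↦ ⟨(g b).toRiemannianMetric⟩
  haveI iXc : ∀ b, IsContMDiffRiemannianBundle 𝓘(ℝ, Fin n → ℂ) ∞ (Fin n → ℂ)
      (fun x : ComplexPoints (fiberOver f b) ↦ TangentSpace 𝓘(ℝ, Fin n → ℂ) x) :=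
    fun b ↦ ⟨(g b).inner, (g b).contMDiff, fun _ _ _ ↦ rfl⟩
  haveI iXcc : ∀ b, IsContinuousRiemannianBundle (Fin n → ℂ)
      (fun x : ComplexPoints (fiberOver f b) ↦ TangentSpace 𝓘(ℝ, Fin n → ℂ) x) :=
    fun b ↦ isContinuousRiemannianBundle_of_isContMDiffRiemannianBundle 𝓘(ℝ, Fin n → ℂ) ∞
  haveI hfact : Fact (Module.finrank ℝ (Fin n → ℂ) = 2 * n) :=
    ⟨by rw [finrank_real_of_complex, Module.finrank_fin_fun]⟩
  have hEX : Module.finrank ℝ (Fin n → ℂ) = 2 * n := hfact.out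
  have hN : 0 < 2 * n := by omega
  haveI : Nonempty (Fin (2 * n)) := ⟨⟨0, hN⟩⟩
  obtain ⟨o₀c, ho₀c, -⟩ := exists_orientation_cintegral_ne_zero_algebraicChart (hX t₁)
    (m := 2 * n) rfl
  let o₀ : (x : ComplexPoints (fiberOver f t₁)) →
      Orientation ℝ (TangentSpace 𝓘(ℝ, Fin n → ℂ) x) (Fin (2 * n)) := fun _ ↦ o₀c
  have ho₀ : IsSmoothForm (riemannianVolumeForm o₀) :=
    isSmoothForm_riemannianVolumeForm_of_isContinuousOrientation_holds o₀ ho₀c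
  haveI hF₀ : Fact (IsSmoothForm (riemannianVolumeForm o₀)) := ⟨ho₀⟩
  let bfr : ∀ x : ComplexPoints (fiberOver f t₁),
      OrthonormalBasis (Fin (2 * n)) ℝ (TangentSpace 𝓘(ℝ, Fin n → ℂ) x) := fun x ↦
    ((stdOrthonormalBasis ℝ (TangentSpace 𝓘(ℝ, Fin n → ℂ) x)).reindex (finCongr hEX)).adjustToOrientation
      (o₀ x)
  have hbfr : ∀ x, (bfr x).toBasis.orientation = o₀ x := fun x ↦
    OrthonormalBasis.orientation_adjustToOrientation _ _
  obtain ⟨m, hkm⟩ : ∃ m, k + (m + 1) = 2 * n := ⟨2 * n - k - 1, by omega⟩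
  -- ### brick K1: the continuous families of harmonic projectors, one for each `p`
  have hK1 := fun p : ℕ ↦ exists_continuousOn_harmonicProjector_family_dep G (O := Set.univ)
    (ι := fun b ↦ (AlgPoints.map (fiberι f b) : ComplexPoints (fiberOver f b) → ComplexPoints 𝒳))
    (fun b _ ↦ hιall b) g (fun b _ ↦ hg b) (fun b _ ↦ hgK b) hbO hΦsm e he (Set.mem_univ t₁) hΦ0
    hr hN o₀ hkm p ho₀ bfr hbfr
  choose oK r₁ hrm L hΦo hovK hr₁ hr₁r hharm hL hker hLc using hK1
  -- ### brick K3: `dim H^k_dR` and `dim F^p H^k` of the fibres are constant near `t₁`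
  have hct₁ : t₁ ∈ (extChartAt 𝓘(ℂ, Fin d → ℂ) t₁).source := mem_extChartAt_source (I := 𝓘(ℂ, Fin d → ℂ)) t₁
  have hπℝ : ContMDiff 𝓘(ℝ, Fin (n + d) → ℂ) 𝓘(ℝ, Fin d → ℂ) ∞
      (AlgPoints.map f : ComplexPoints 𝒳 → ComplexPoints S) :=
    contMDiff_real_of_mdifferentiable (hπ.contMDiff.mdifferentiable (by simp))
  have hsub : ∀ x : ComplexPoints 𝒳, (AlgPoints.map f : ComplexPoints 𝒳 → ComplexPoints S) x ∈
      (Set.univ : Set (ComplexPoints S)) →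
      Surjective (mfderiv 𝓘(ℝ, Fin (n + d) → ℂ) 𝓘(ℝ, Fin d → ℂ)
        (AlgPoints.map f : ComplexPoints 𝒳 → ComplexPoints S) x) :=
    fun x _ ↦ hπ.surjective_mfderiv_real x
  have hprop : ∀ K ⊆ (Set.univ : Set (ComplexPoints S)), IsCompact K →
      IsCompact ((AlgPoints.map f : ComplexPoints 𝒳 → ComplexPoints S) ⁻¹' K) :=
    fun K _ hK ↦ hπ.isProperMap.isCompact_preimage hK
  have hb : ∀ᶠ b in 𝓝 t₁,
      finrank ℂ (complexDeRhamCohomology (Fin n → ℂ) (ComplexPoints (fiberOver f b)) k) =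
        finrank ℂ (complexDeRhamCohomology (Fin n → ℂ) (ComplexPoints (fiberOver f t₁)) k) := by
    filter_upwards [extChartAt_source_mem_nhds (I := 𝓘(ℂ, Fin d → ℂ)) t₁,
      (continuousAt_extChartAt (I := 𝓘(ℂ, Fin d → ℂ)) t₁).preimage_mem_nhds (ball_mem_nhds _ hr)]
      with b hb₁ hb₂
    have h := (LinearEquiv.ofBijective _
      (complexDeRhamCohomology.map_diffeomorph_bijective (e (extChartAt 𝓘(ℂ, Fin d → ℂ) t₁ b) hb₂) k)).finrank_eq
    rw [(extChartAt 𝓘(ℂ, Fin d → ℂ) t₁).left_inv hb₁] at h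
    exact h
  have hK3 := eventually_finrank_hodgeFiltration_eq_of_fibres G hG hπℝ isOpen_univ (Set.mem_univ t₁)
    hsub hprop
    (fun b ↦ (AlgPoints.map (fiberι f b) : ComplexPoints (fiberOver f b) → ComplexPoints 𝒳))
    (fun b _ ↦ (hιall b).contMDiff_real) (fun b _ ↦ (hιall b).isClosedEmbedding.injective)
    (fun b _ ↦ (hιall b).injective_mfderiv_real)
    (fun b _ y v ↦ by
      rw [tangentJ_apply, tangentJ_apply]
      exact mfderiv_real_apply_smul ((hιall b).contMDiff.mdifferentiableAt (by simp)) Complex.I v)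
    (fun b _ ↦ (hιall b).range_eq) (k := k) (by omega : k ≤ 2 * n) hb
  -- a ball on which the ranks are constant
  let Rk : ℕ → ℕ := fun p ↦ finrank ℂ ↥(⨆ pq ∈ {pq ∈ antidiagonal k | p ≤ pq.1},
    hodgePQ (Fin n → ℂ) (ComplexPoints (fiberOver f t₁)) k pq.1 pq.2)
  obtain ⟨r₂, hr₂, hr₂R⟩ : ∃ r₂ > 0, ∀ z ∈ ball (extChartAt 𝓘(ℂ, Fin d → ℂ) t₁ t₁) r₂, ∀ p,
      finrank ℂ ↥(⨆ pq ∈ {pq ∈ antidiagonal k | p ≤ pq.1},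
        hodgePQ (Fin n → ℂ) (ComplexPoints (fiberOver f ((extChartAt 𝓘(ℂ, Fin d → ℂ) t₁).symm z)))
          k pq.1 pq.2) = Rk p := by
    have hcs : ContinuousAt (extChartAt 𝓘(ℂ, Fin d → ℂ) t₁).symm (extChartAt 𝓘(ℂ, Fin d → ℂ) t₁ t₁) :=
      continuousAt_extChartAt_symm (I := 𝓘(ℂ, Fin d → ℂ)) t₁
    have hK3' : {b | ∀ p : ℕ, finrank ℂ ↥(⨆ pq ∈ {pq ∈ antidiagonal k | p ≤ pq.1},
        hodgePQ (Fin n → ℂ) (ComplexPoints (fiberOver f b)) k pq.1 pq.2) = Rk p} ∈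
        𝓝 ((extChartAt 𝓘(ℂ, Fin d → ℂ) t₁).symm (extChartAt 𝓘(ℂ, Fin d → ℂ) t₁ t₁)) := by
      rw [extChartAt_to_inv (I := 𝓘(ℂ, Fin d → ℂ)) t₁]; exact hK3
    exact Metric.mem_nhds_iff.1 (hcs.preimage_mem_nhds hK3')
  -- ### Poincaré duality for the wedge pairing on the fibres (brick K4b), for the transported
  -- orientations `oK (k+1) z` (their volume forms are smooth, hence have positive integral)
  have hPD : ∀ z (hz : z ∈ ball (extChartAt 𝓘(ℂ, Fin d → ℂ) t₁ t₁) r),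
      ∀ θ : cclosedSmoothForms (Fin n → ℂ)
        (ComplexPoints (fiberOver f ((extChartAt 𝓘(ℂ, Fin d → ℂ) t₁).symm z))) k,
      complexDeRhamCohomology.mk (Fin n → ℂ)
        (ComplexPoints (fiberOver f ((extChartAt 𝓘(ℂ, Fin d → ℂ) t₁).symm z))) k θ ≠ 0 →
      ∃ γ : cclosedSmoothForms (Fin n → ℂ)
        (ComplexPoints (fiberOver f ((extChartAt 𝓘(ℂ, Fin d → ℂ) t₁).symm z))) (m + 1),
        cintegral (oK (k + 1) z) ((θ.1.wedge γ.1).castDeg hkm) ≠ 0 :=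
    fun z hz θ hθ ↦ exists_cintegral_wedge_ne_zero_of_riemannianVolumeForm (hX _) hkm (g _)
      (oK (k + 1) z) (hovK (k + 1) z hz) θ hθ
  -- ### the representation clause of the full harmonic transport `R = L (k+1)`
  have hrep : ∀ (p' : ℕ) z (hz : z ∈ ball (extChartAt 𝓘(ℂ, Fin d → ℂ) t₁ t₁) r)
      (cc : complexDeRhamCohomology (Fin n → ℂ) (ComplexPoints (fiberOver f t₁)) k),
      ∃ (η : MForm 𝓘(ℝ, Fin n → ℂ)
          (ComplexPoints (fiberOver f ((extChartAt 𝓘(ℂ, Fin d → ℂ) t₁).symm z))) ℂ k)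
        (hη : η ∈ cclosedSmoothForms (Fin n → ℂ)
          (ComplexPoints (fiberOver f ((extChartAt 𝓘(ℂ, Fin d → ℂ) t₁).symm z))) k),
        CL2SmoothForms.toForm o₀ (L (k + 1) z cc) = η.pullback 𝓘(ℝ, Fin n → ℂ) (e z hz) ∧
        cc = complexDeRhamCohomology.map (Fin n → ℂ) (e z hz).contMDiff k
          (complexDeRhamCohomology.mk (Fin n → ℂ)
            (ComplexPoints (fiberOver f ((extChartAt 𝓘(ℂ, Fin d → ℂ) t₁).symm z))) k ⟨η, hη⟩) ∧
        (L p' z cc = 0 → ∀ (y : ComplexPoints (fiberOver f ((extChartAt 𝓘(ℂ, Fin d → ℂ) t₁).symm z)))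
          (r' s : ℕ), r' < p' →
          typeProjAt r' s (show (Fin n → ℂ) [⋀^Fin k]→L[ℝ] ℂ from η y) = 0) := by
    intro p' z hz cc
    refine ⟨(hrm (k + 1) z hz (complexDeRhamCohomology.map (Fin n → ℂ) (e z hz).symm.contMDiff k cc)).1,
      (hrm (k + 1) z hz _).2, ?_, ?_, ?_⟩
    · rw [hL (k + 1) z hz cc]
      congr 1
      rw [show (antidiagonal k).filter (fun pq ↦ pq.1 < k + 1) = antidiagonal k from
        Finset.filter_true_of_mem fun pq hpq ↦ by
          have := HasAntidiagonal.mem_antidiagonal.1 hpq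
          omega]
      exact sum_antidiagonal_typeComponent_holds _
    · rw [Subtype.coe_eta, (hharm (k + 1) z hz _).2, complexDeRhamCohomology.map_apply_map_symm]
    · intro h0 y r' s hr's
      have hmem : complexDeRhamCohomology.map (Fin n → ℂ) (e z hz).symm.contMDiff k cc ∈
          ⨆ pq ∈ {pq ∈ antidiagonal k | p' ≤ pq.1}, hodgePQ (Fin n → ℂ)
            (ComplexPoints (fiberOver f ((extChartAt 𝓘(ℂ, Fin d → ℂ) t₁).symm z))) k pq.1 pq.2 := by
        have h1 : cc ∈ LinearMap.ker (L p' z) := LinearMap.mem_ker.2 h0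
        rw [hker p' z hz, Submodule.mem_map] at h1
        obtain ⟨v, hv, hvc⟩ := h1
        rw [← hvc, complexDeRhamCohomology.map_symm_apply_map]
        exact hv
      have hF := ((mem_hodgeFiltration_iff_typeComponent_eq_zero
        (g ((extChartAt 𝓘(ℂ, Fin d → ℂ) t₁).symm z)) (oK (k + 1) z) (hgK _) hkm p'
        (hovK (k + 1) z hz) (hrm (k + 1) z hz _) (hharm (k + 1) z hz _).1).1
        (by rwa [(hharm (k + 1) z hz _).2])) r' s hr's
      rw [← typeComponent_apply' r' s, hF]
      rfl
  -- ### brick K7g, for each `p'`: analytic frames of `(e z)^* F^{p'}` on a ball `ball (c t₁) (r₀' p')`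
  haveI hfin : FiniteDimensional ℂ
      (complexDeRhamCohomology (Fin n → ℂ) (ComplexPoints (fiberOver f t₁)) k) :=
    complexDeRhamCohomology.finite_of_compactSpace (Fin n → ℂ) (ComplexPoints (fiberOver f t₁)) k
  have hρ : ∀ p' : ℕ, 0 < min (min (r₁ p') (r₁ (k + 1))) r₂ := fun p' ↦
    lt_min (lt_min (hr₁ p') (hr₁ _)) hr₂
  have hρr : ∀ p' : ℕ, min (min (r₁ p') (r₁ (k + 1))) r₂ ≤ r := fun p' ↦
    (min_le_left _ _).trans ((min_le_left _ _).trans (hr₁r p'))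
  have hρball : ∀ p' : ℕ, ball (extChartAt 𝓘(ℂ, Fin d → ℂ) t₁ t₁) (min (min (r₁ p') (r₁ (k + 1))) r₂) ⊆
      ball (extChartAt 𝓘(ℂ, Fin d → ℂ) t₁ t₁) r := fun p' ↦ ball_subset_ball (hρr p')
  have hρball₂ : ∀ p' : ℕ, ball (extChartAt 𝓘(ℂ, Fin d → ℂ) t₁ t₁) (min (min (r₁ p') (r₁ (k + 1))) r₂) ⊆
      ball (extChartAt 𝓘(ℂ, Fin d → ℂ) t₁ t₁) r₂ := fun p' ↦ ball_subset_ball (min_le_right _ _)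
  have hK7 := fun p' : ℕ ↦ exists_analyticFrames_hodgeFiltration_chartBall hπ (O := Set.univ)
    (s₀ := t₁) (X := fun b ↦ ComplexPoints (fiberOver f b))
    (ι := fun b ↦ (AlgPoints.map (fiberι f b) : ComplexPoints (fiberOver f b) → ComplexPoints 𝒳))
    (fun b _ ↦ hιall b) hdim o₀ ho₀ hbt hbO hπΦ hΦsm e he hΛs hΛΦ hkm p' (hρ p') (hρr p')
    (fun z _ ↦ g ((extChartAt 𝓘(ℂ, Fin d → ℂ) t₁).symm z)) (fun z _ ↦ hgK _)
    (fun z _ ↦ oK (k + 1) z)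
    (fun z hz ↦ isContinuousOrientation_of_isSmoothForm_riemannianVolumeForm_holds (oK (k + 1) z)
      (hovK (k + 1) z (hρball p' hz)))
    (fun z hz ↦ hovK (k + 1) z (hρball p' hz)) (fun z hz x ↦ hΦo (k + 1) z (hρball p' hz) x)
    (fun z hz θ hθ ↦ hPD z (hρball p' hz) θ hθ) (Rk := Rk p') (fun z hz ↦ hr₂R z (hρball₂ p' hz) p')
    (L p') (L (k + 1))
    (fun cc ↦ (hLc p' cc).mono (ball_subset_ball ((min_le_left _ _).trans (min_le_left _ _))))
    (fun cc ↦ (hLc (k + 1) cc).mono (ball_subset_ball ((min_le_left _ _).trans (min_le_right _ _))))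
    (fun z hz ↦ hker p' z (hρball p' hz)) (fun z hz cc ↦ hrep p' z (hρball p' hz) cc)
  choose r₀' hr₀' hr₀'ρ w' hwan' hwframe' using hK7
  -- ### the common radius `r₀` (frames for `p > k` are those of `p = k + 1`, i.e. empty) and the frames
  have hfilt : ∀ p : ℕ, ∀ M : Type, ∀ _ : TopologicalSpace M, ∀ _ : ChartedSpace (Fin n → ℂ) M,
      (⨆ pq ∈ {pq ∈ antidiagonal k | min p (k + 1) ≤ pq.1}, hodgePQ (Fin n → ℂ) M k pq.1 pq.2) =
        ⨆ pq ∈ {pq ∈ antidiagonal k | p ≤ pq.1}, hodgePQ (Fin n → ℂ) M k pq.1 pq.2 := by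
    intro p M _ _
    rw [Finset.filter_congr (q := fun pq ↦ p ≤ pq.1) fun pq hpq ↦ by
      have := HasAntidiagonal.mem_antidiagonal.1 hpq
      constructor <;> intro h <;> omega]
  have hne' : (Finset.range (k + 2)).Nonempty := ⟨0, by simp⟩
  have hr₀P : ∀ p : ℕ, min r ((Finset.range (k + 2)).inf' hne' r₀') ≤ r₀' (min p (k + 1)) := fun p ↦
    (min_le_right _ _).trans (Finset.inf'_le _ (by simp))
  refine ⟨r, Φ, e, min r ((Finset.range (k + 2)).inf' hne' r₀'), fun p ↦ Rk (min p (k + 1)),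
    fun p ↦ w' (min p (k + 1)), hr, hbt, hΦ0, hπΦ, hΦsm, himm, he,
    lt_min hr ((Finset.lt_inf'_iff _).2 fun p _ ↦ hr₀' p), min_le_left _ _, ?_, ?_⟩
  · intro p i φ
    exact (hwan' (min p (k + 1)) i φ).mono (ball_subset_ball (hr₀P p))
  · intro p z hz hzr
    obtain ⟨hli, hspan⟩ := hwframe' (min p (k + 1)) z (ball_subset_ball (hr₀P p) hz) hzr
    refine ⟨hli, ?_⟩
    rw [hspan, hfilt p]


/-- **The degenerate degrees `k ≥ 2n`**: the same chart-ball data, with CONSTANT frames (a fixed basis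
of `H^k_dR(X_{t₁})`, when `k = 2n` and `p ≤ n`: `F^p = H^{2n} = H^{n,n}`) or EMPTY frames (otherwise:
`F^p = 0`), by `biSup_hodgePQ_eq_of_two_mul_le` and the Hodge decomposition of the algebraic-chart
models of the fibres. [cite: VoisinHodgeI2002, §7.1.1 and §9.1.1 Thm. 9.3] -/
theorem exists_chartBall_hodgeFrames_of_two_mul_le {n d : ℕ} (k : ℕ) (hkn : 2 * n ≤ k)
    (hf : IsSmoothProjectiveFamily f n) (h𝒳 : IsQuasiProjectiveOver 𝒳)
    [AlgebraicGeometry.SmoothOfRelativeDimension d S.hom] [AlgebraicGeometry.IsSeparated S.hom]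
    (t₁ : ComplexPoints S) :
    letI := Motives.smoothOfRelativeDimension_total (m := d) f hf
    letI : AlgebraicGeometry.Smooth 𝒳.hom := AlgebraicGeometry.SmoothOfRelativeDimension.smooth (n + d) _
    letI : AlgebraicGeometry.LocallyOfFiniteType 𝒳.hom := inferInstance
    letI : AlgebraicGeometry.Smooth S.hom := AlgebraicGeometry.SmoothOfRelativeDimension.smooth d _
    letI : AlgebraicGeometry.LocallyOfFiniteType S.hom := inferInstance
    letI := chartedSpaceOfCharts (ComplexPoints.algebraicChart 𝒳 (n + d))
      (ComplexPoints.mem_algebraicChart_source 𝒳 (n + d))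
    letI := chartedSpaceOfCharts (ComplexPoints.algebraicChart S d)
      (ComplexPoints.mem_algebraicChart_source S d)
    letI : ∀ b : ComplexPoints S, ChartedSpace (Fin n → ℂ) (ComplexPoints (fiberOver f b)) :=
      fun b ↦ (algebraicModel (hf.isSmoothProjective b)).chartedSpace
    haveI : ∀ b : ComplexPoints S, IsManifold 𝓘(ℝ, Fin n → ℂ) ∞ (ComplexPoints (fiberOver f b)) :=
      fun b ↦ (algebraicModel (hf.isSmoothProjective b)).isManifold_real
    ∃ (r : ℝ) (Φ : (Fin d → ℂ) → ComplexPoints (fiberOver f t₁) → ComplexPoints 𝒳)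
      (e : ∀ p ∈ ball (extChartAt 𝓘(ℂ, Fin d → ℂ) t₁ t₁) r,
        ComplexPoints (fiberOver f t₁) ≃ₘ^∞⟮𝓘(ℝ, Fin n → ℂ), 𝓘(ℝ, Fin n → ℂ)⟯
          ComplexPoints (fiberOver f ((extChartAt 𝓘(ℂ, Fin d → ℂ) t₁).symm p)))
      (r₀ : ℝ) (R : ℕ → ℕ)
      (w : ∀ p : ℕ, Fin (R p) → (Fin d → ℂ) →
        complexDeRhamCohomology (Fin n → ℂ) (ComplexPoints (fiberOver f t₁)) k),
      0 < r ∧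
      ball (extChartAt 𝓘(ℂ, Fin d → ℂ) t₁ t₁) r ⊆ (extChartAt 𝓘(ℂ, Fin d → ℂ) t₁).target ∧
      (∀ x, Φ (extChartAt 𝓘(ℂ, Fin d → ℂ) t₁ t₁) x = AlgPoints.map (fiberι f t₁) x) ∧
      (∀ p ∈ ball (extChartAt 𝓘(ℂ, Fin d → ℂ) t₁ t₁) r, ∀ x,
        AlgPoints.map f (Φ p x) = (extChartAt 𝓘(ℂ, Fin d → ℂ) t₁).symm p) ∧
      ContMDiffOn (𝓘(ℝ, Fin d → ℂ).prod 𝓘(ℝ, Fin n → ℂ)) 𝓘(ℝ, Fin (n + d) → ℂ) ∞ (uncurry Φ)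
        (ball (extChartAt 𝓘(ℂ, Fin d → ℂ) t₁ t₁) r ×ˢ univ) ∧
      (∀ p ∈ ball (extChartAt 𝓘(ℂ, Fin d → ℂ) t₁ t₁) r,
        ContMDiff 𝓘(ℝ, Fin n → ℂ) 𝓘(ℝ, Fin (n + d) → ℂ) ∞ (Φ p) ∧ Injective (Φ p) ∧
          (∀ x, Injective (mfderiv 𝓘(ℝ, Fin n → ℂ) 𝓘(ℝ, Fin (n + d) → ℂ) (Φ p) x)) ∧
          range (Φ p) = (AlgPoints.map f : ComplexPoints 𝒳 → ComplexPoints S) ⁻¹'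
            {(extChartAt 𝓘(ℂ, Fin d → ℂ) t₁).symm p}) ∧
      (∀ p (hp : p ∈ ball (extChartAt 𝓘(ℂ, Fin d → ℂ) t₁ t₁) r), ∀ x,
        AlgPoints.map (fiberι f ((extChartAt 𝓘(ℂ, Fin d → ℂ) t₁).symm p)) (e p hp x) = Φ p x) ∧
      0 < r₀ ∧ r₀ ≤ r ∧
      (∀ p i (φ : Module.Dual ℂ (complexDeRhamCohomology (Fin n → ℂ) (ComplexPoints (fiberOver f t₁)) k)),
        AnalyticOnNhd ℂ (fun z ↦ φ (w p i z)) (ball (extChartAt 𝓘(ℂ, Fin d → ℂ) t₁ t₁) r₀)) ∧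
      (∀ p z (_ : z ∈ ball (extChartAt 𝓘(ℂ, Fin d → ℂ) t₁ t₁) r₀)
        (hzr : z ∈ ball (extChartAt 𝓘(ℂ, Fin d → ℂ) t₁ t₁) r),
        LinearIndependent ℂ (fun i ↦ w p i z) ∧
        Submodule.span ℂ (Set.range fun i ↦ w p i z) =
          (⨆ pq ∈ {pq ∈ antidiagonal k | p ≤ pq.1},
            hodgePQ (Fin n → ℂ) (ComplexPoints (fiberOver f ((extChartAt 𝓘(ℂ, Fin d → ℂ) t₁).symm z)))
              k pq.1 pq.2).map
            (complexDeRhamCohomology.map (Fin n → ℂ) (e z hzr).contMDiff k)) := by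
  -- ### instances (as in `exists_weightFrames_of_relativeForms`)
  haveI := Motives.smoothOfRelativeDimension_total (m := d) f hf
  haveI : AlgebraicGeometry.Smooth 𝒳.hom := AlgebraicGeometry.SmoothOfRelativeDimension.smooth (n + d) _
  haveI : AlgebraicGeometry.LocallyOfFiniteType 𝒳.hom := inferInstance
  haveI : AlgebraicGeometry.Smooth S.hom := AlgebraicGeometry.SmoothOfRelativeDimension.smooth d _
  haveI : AlgebraicGeometry.LocallyOfFiniteType S.hom := inferInstance
  letI csT := chartedSpaceOfCharts (ComplexPoints.algebraicChart 𝒳 (n + d))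
    (ComplexPoints.mem_algebraicChart_source 𝒳 (n + d))
  letI csB := chartedSpaceOfCharts (ComplexPoints.algebraicChart S d)
    (ComplexPoints.mem_algebraicChart_source S d)
  classical
  have hX : ∀ t : ComplexPoints S, IsSmoothProjective n (fiberOver f t) := fun t ↦ hf.isSmoothProjective t
  haveI : IsManifold 𝓘(ℂ, Fin (n + d) → ℂ) ω (ComplexPoints 𝒳) := isManifold_algebraicChart 𝒳 (n + d)
  haveI : IsManifold 𝓘(ℂ, Fin d → ℂ) ω (ComplexPoints S) := isManifold_algebraicChart S d
  haveI : IsManifold 𝓘(ℝ, Fin (n + d) → ℂ) ∞ (ComplexPoints 𝒳) := isManifold_real_of_isManifold_complex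
  haveI : IsManifold 𝓘(ℝ, Fin d → ℂ) ∞ (ComplexPoints S) := isManifold_real_of_isManifold_complex
  haveI : AlgebraicGeometry.IsSeparated 𝒳.hom := h𝒳.isVarietyPair_ofScheme.isSeparated
  haveI : T2Space (ComplexPoints 𝒳) := ComplexPoints.t2Space_of_isSeparated 𝒳
  haveI : T2Space (ComplexPoints S) := ComplexPoints.t2Space_of_isSeparated S
  haveI : AlgebraicGeometry.QuasiCompact 𝒳.hom := h𝒳.isVarietyPair_ofScheme.quasiCompact
  haveI : CompactSpace 𝒳.left := QuasiCompact.compactSpace_of_compactSpace 𝒳.hom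
  haveI : SecondCountableTopology (ComplexPoints 𝒳) :=
    ComplexPoints.secondCountableTopology_of_compactSpace_holds _
  haveI : LocallyCompactSpace (ComplexPoints 𝒳) := ChartedSpace.locallyCompactSpace (Fin (n + d) → ℂ) _
  haveI : SigmaCompactSpace (ComplexPoints 𝒳) := sigmaCompactSpace_of_locallyCompact_secondCountable
  haveI : NormalSpace (ComplexPoints 𝒳) := inferInstance
  -- the fibres, with the algebraic charts of `algebraicModel`
  letI csF : ∀ b : ComplexPoints S, ChartedSpace (Fin n → ℂ) (ComplexPoints (fiberOver f b)) :=
    fun b ↦ (algebraicModel (hX b)).chartedSpace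
  haveI : ∀ b, IsManifold 𝓘(ℂ, Fin n → ℂ) ω (ComplexPoints (fiberOver f b)) :=
    fun b ↦ (algebraicModel (hX b)).isManifold
  haveI : ∀ b, IsManifold 𝓘(ℝ, Fin n → ℂ) ∞ (ComplexPoints (fiberOver f b)) :=
    fun b ↦ (algebraicModel (hX b)).isManifold_real
  haveI : ∀ b, T2Space (ComplexPoints (fiberOver f b)) :=
    fun b ↦ ComplexPoints.t2Space_of_isSmoothProjective (hX b)
  haveI : ∀ b, CompactSpace (ComplexPoints (fiberOver f b)) :=
    fun b ↦ ComplexPoints.compactSpace_of_isSmoothProjective (hX b)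
  haveI : ∀ b, SigmaCompactSpace (ComplexPoints (fiberOver f b)) :=
    fun b ↦ (algebraicModel (hX b)).sigmaCompactSpace
  haveI hne : ∀ b : ComplexPoints S, Nonempty (ComplexPoints (fiberOver f b)) :=
    fun b ↦ (algebraicModel (hX b)).nonempty_carrier (hX b)
  -- `f(ℂ)` is a proper holomorphic submersion; the fibre embeddings
  obtain ⟨hπ, hιall⟩ := isProperHolomorphicSubmersion_and_isFibreEmbedding_of_isSmoothProjectiveFamily
    (m := d) f hf
  have hdim : Module.finrank ℂ (Fin n → ℂ) + Module.finrank ℂ (Fin d → ℂ) =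
      Module.finrank ℂ (Fin (n + d) → ℂ) := finrank_fibre_add_base n d
  -- ### the chart-ball trivialisation at `t₁` (brick K0b)
  obtain ⟨r, Φ, Λ, hr, hbt, -, hΦ0, hπΦ, hΦsm, himm, hee, -, -, -, -⟩ :=
    hπ.exists_chartBall_trivialisation_inverse isOpen_univ (Set.mem_univ t₁)
      (X := fun b ↦ ComplexPoints (fiberOver f b))
      (ι := fun b ↦ (AlgPoints.map (fiberι f b) : ComplexPoints (fiberOver f b) → ComplexPoints 𝒳))
      (fun b _ ↦ hιall b)
  choose e he using hee
  -- ### in degrees `k ≥ 2n` the filtration steps are `⊤` or `⊥`: constant or empty frames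
  haveI hfin : FiniteDimensional ℂ
      (complexDeRhamCohomology (Fin n → ℂ) (ComplexPoints (fiberOver f t₁)) k) :=
    complexDeRhamCohomology.finite_of_compactSpace (Fin n → ℂ) (ComplexPoints (fiberOver f t₁)) k
  have hF : ∀ (b : ComplexPoints S) (p : ℕ),
      (⨆ pq ∈ {pq ∈ antidiagonal k | p ≤ pq.1},
        hodgePQ (Fin n → ℂ) (ComplexPoints (fiberOver f b)) k pq.1 pq.2) =
        if k = 2 * n ∧ p ≤ n then ⊤ else ⊥ := fun b p ↦
    biSup_hodgePQ_eq_of_two_mul_le hkn (M := ComplexPoints (fiberOver f b))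
      ((algebraicModel (hX b)).isInternal_hodgePQ k) p
  have hw : ∀ p : ℕ, ∃ (R : ℕ) (w : Fin R → (Fin d → ℂ) →
      complexDeRhamCohomology (Fin n → ℂ) (ComplexPoints (fiberOver f t₁)) k),
      (∀ i (φ : Module.Dual ℂ (complexDeRhamCohomology (Fin n → ℂ) (ComplexPoints (fiberOver f t₁)) k)),
        AnalyticOnNhd ℂ (fun z ↦ φ (w i z)) (ball (extChartAt 𝓘(ℂ, Fin d → ℂ) t₁ t₁) r)) ∧
      ∀ z (_ : z ∈ ball (extChartAt 𝓘(ℂ, Fin d → ℂ) t₁ t₁) r)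
        (hzr : z ∈ ball (extChartAt 𝓘(ℂ, Fin d → ℂ) t₁ t₁) r),
        LinearIndependent ℂ (fun i ↦ w i z) ∧
        Submodule.span ℂ (Set.range fun i ↦ w i z) =
          (⨆ pq ∈ {pq ∈ antidiagonal k | p ≤ pq.1},
            hodgePQ (Fin n → ℂ) (ComplexPoints (fiberOver f ((extChartAt 𝓘(ℂ, Fin d → ℂ) t₁).symm z)))
              k pq.1 pq.2).map
            (complexDeRhamCohomology.map (Fin n → ℂ) (e z hzr).contMDiff k) := by
    intro p
    by_cases hcase : k = 2 * n ∧ p ≤ n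
    · -- the whole cohomology: a fixed basis of `H^k_dR(X_{t₁})`
      let bH := Module.finBasis ℂ (complexDeRhamCohomology (Fin n → ℂ) (ComplexPoints (fiberOver f t₁)) k)
      refine ⟨_, fun i _ ↦ bH i, fun i φ ↦ analyticOnNhd_const, fun z _ hzr ↦ ⟨bH.linearIndependent, ?_⟩⟩
      rw [hF _ p, if_pos hcase, Submodule.map_top, LinearMap.range_eq_top.2
        (complexDeRhamCohomology.map_diffeomorph_surjective (e z hzr) k)]
      exact bH.span_eq
    · -- nothing
      refine ⟨0, fun i ↦ i.elim0, fun i ↦ i.elim0, fun z _ hzr ↦ ⟨linearIndependent_empty_type, ?_⟩⟩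
      rw [hF _ p, if_neg hcase, Submodule.map_bot, Set.range_eq_empty, Submodule.span_empty]
  choose R w hwan hwframe using hw
  exact ⟨r, Φ, e, r, R, w, hr, hbt, hΦ0, hπΦ, hΦsm, himm, he, hr, le_rfl, hwan, hwframe⟩

/-- **Analytic frames of the Hodge bundles of a smooth projective family with quasi-projective total
space, over a chart ball of the base, in every degree** (the two previous theorems).
[cite: VoisinHodgeI2002, §10.2.1 Thm. 10.3 and §10.1.2 Thm. 10.9] [cite: Griffiths1968PeriodsII, Thm. 1.1] -/
theorem exists_chartBall_hodgeFrames {n d : ℕ} (k : ℕ)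
    (hf : IsSmoothProjectiveFamily f n) (h𝒳 : IsQuasiProjectiveOver 𝒳)
    [AlgebraicGeometry.SmoothOfRelativeDimension d S.hom] [AlgebraicGeometry.IsSeparated S.hom]
    (t₁ : ComplexPoints S) :
    letI := Motives.smoothOfRelativeDimension_total (m := d) f hf
    letI : AlgebraicGeometry.Smooth 𝒳.hom := AlgebraicGeometry.SmoothOfRelativeDimension.smooth (n + d) _
    letI : AlgebraicGeometry.LocallyOfFiniteType 𝒳.hom := inferInstance
    letI : AlgebraicGeometry.Smooth S.hom := AlgebraicGeometry.SmoothOfRelativeDimension.smooth d _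
    letI : AlgebraicGeometry.LocallyOfFiniteType S.hom := inferInstance
    letI := chartedSpaceOfCharts (ComplexPoints.algebraicChart 𝒳 (n + d))
      (ComplexPoints.mem_algebraicChart_source 𝒳 (n + d))
    letI := chartedSpaceOfCharts (ComplexPoints.algebraicChart S d)
      (ComplexPoints.mem_algebraicChart_source S d)
    letI : ∀ b : ComplexPoints S, ChartedSpace (Fin n → ℂ) (ComplexPoints (fiberOver f b)) :=
      fun b ↦ (algebraicModel (hf.isSmoothProjective b)).chartedSpace
    haveI : ∀ b : ComplexPoints S, IsManifold 𝓘(ℝ, Fin n → ℂ) ∞ (ComplexPoints (fiberOver f b)) :=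
      fun b ↦ (algebraicModel (hf.isSmoothProjective b)).isManifold_real
    ∃ (r : ℝ) (Φ : (Fin d → ℂ) → ComplexPoints (fiberOver f t₁) → ComplexPoints 𝒳)
      (e : ∀ p ∈ ball (extChartAt 𝓘(ℂ, Fin d → ℂ) t₁ t₁) r,
        ComplexPoints (fiberOver f t₁) ≃ₘ^∞⟮𝓘(ℝ, Fin n → ℂ), 𝓘(ℝ, Fin n → ℂ)⟯
          ComplexPoints (fiberOver f ((extChartAt 𝓘(ℂ, Fin d → ℂ) t₁).symm p)))
      (r₀ : ℝ) (R : ℕ → ℕ)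
      (w : ∀ p : ℕ, Fin (R p) → (Fin d → ℂ) →
        complexDeRhamCohomology (Fin n → ℂ) (ComplexPoints (fiberOver f t₁)) k),
      0 < r ∧
      ball (extChartAt 𝓘(ℂ, Fin d → ℂ) t₁ t₁) r ⊆ (extChartAt 𝓘(ℂ, Fin d → ℂ) t₁).target ∧
      (∀ x, Φ (extChartAt 𝓘(ℂ, Fin d → ℂ) t₁ t₁) x = AlgPoints.map (fiberι f t₁) x) ∧
      (∀ p ∈ ball (extChartAt 𝓘(ℂ, Fin d → ℂ) t₁ t₁) r, ∀ x,
        AlgPoints.map f (Φ p x) = (extChartAt 𝓘(ℂ, Fin d → ℂ) t₁).symm p) ∧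
      ContMDiffOn (𝓘(ℝ, Fin d → ℂ).prod 𝓘(ℝ, Fin n → ℂ)) 𝓘(ℝ, Fin (n + d) → ℂ) ∞ (uncurry Φ)
        (ball (extChartAt 𝓘(ℂ, Fin d → ℂ) t₁ t₁) r ×ˢ univ) ∧
      (∀ p ∈ ball (extChartAt 𝓘(ℂ, Fin d → ℂ) t₁ t₁) r,
        ContMDiff 𝓘(ℝ, Fin n → ℂ) 𝓘(ℝ, Fin (n + d) → ℂ) ∞ (Φ p) ∧ Injective (Φ p) ∧
          (∀ x, Injective (mfderiv 𝓘(ℝ, Fin n → ℂ) 𝓘(ℝ, Fin (n + d) → ℂ) (Φ p) x)) ∧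
          range (Φ p) = (AlgPoints.map f : ComplexPoints 𝒳 → ComplexPoints S) ⁻¹'
            {(extChartAt 𝓘(ℂ, Fin d → ℂ) t₁).symm p}) ∧
      (∀ p (hp : p ∈ ball (extChartAt 𝓘(ℂ, Fin d → ℂ) t₁ t₁) r), ∀ x,
        AlgPoints.map (fiberι f ((extChartAt 𝓘(ℂ, Fin d → ℂ) t₁).symm p)) (e p hp x) = Φ p x) ∧
      0 < r₀ ∧ r₀ ≤ r ∧
      (∀ p i (φ : Module.Dual ℂ (complexDeRhamCohomology (Fin n → ℂ) (ComplexPoints (fiberOver f t₁)) k)),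
        AnalyticOnNhd ℂ (fun z ↦ φ (w p i z)) (ball (extChartAt 𝓘(ℂ, Fin d → ℂ) t₁ t₁) r₀)) ∧
      (∀ p z (_ : z ∈ ball (extChartAt 𝓘(ℂ, Fin d → ℂ) t₁ t₁) r₀)
        (hzr : z ∈ ball (extChartAt 𝓘(ℂ, Fin d → ℂ) t₁ t₁) r),
        LinearIndependent ℂ (fun i ↦ w p i z) ∧
        Submodule.span ℂ (Set.range fun i ↦ w p i z) =
          (⨆ pq ∈ {pq ∈ antidiagonal k | p ≤ pq.1},
            hodgePQ (Fin n → ℂ) (ComplexPoints (fiberOver f ((extChartAt 𝓘(ℂ, Fin d → ℂ) t₁).symm z)))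
              k pq.1 pq.2).map
            (complexDeRhamCohomology.map (Fin n → ℂ) (e z hzr).contMDiff k)) := by
  by_cases hkn : k < 2 * n
  · exact exists_chartBall_hodgeFrames_of_isSmoothProjectiveFamily f k hkn hf h𝒳 t₁
  · exact exists_chartBall_hodgeFrames_of_two_mul_le f k (not_lt.1 hkn) hf h𝒳 t₁

end Frames

end Literature.AlgebraicGeometry.HodgeTheory

end
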